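/-
Copyright (c) 2026 the pub-hodgecm-mathlib formalisation cell (harness21).  Prover seat hodgecm-mathlib-R90-C131-p05 (g2), R90-TF SLAB section S4
«Ch13.1–2» (base R90-C131), h413 = `stmt-HodgeConjecture-24833`; brick (W̃ε-VAL)(1) (S4 dealer K2E2-plan (g7), R90 bus 2026-09-05T01:51:00Z, booked 01:41:36Z).
-/
import Summits.HodgeConjecture.HodgeConjecture.Theorems.R90S4TypeOneWeylIndex            -- (this seat) F4 C: §0 transport lemmas, `formCongr_eigenframe_eq_diagonal`; brings F4 A∕B (`torusU` normaliser = monomials, index `6` at `a := 0`)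
import Summits.HodgeConjecture.HodgeConjecture.Theorems.R90S4EpsWeylFinite               -- (this seat) ★ p864025 WEYL-ε: the ε-normaliser predicate, `le_normalizer_of_mem_iff_epsNormalizer`; brings `epsLoc`, `GtLoc`
import HarnessLib

/-!
# R90-TF · S4 — (W̃ε-VAL)(1) `R90S4TypeOneEpsWeylIndex`: for a type-(1) Cartan subgroup the ε-twisted Weyl group `W̃^ε_T = Ñ^ε_T ∕ T̃` has order `6` — the ε-normaliser of
# `T̃ = Cent_{G̃_v}(γ₀)` IS the full normaliser, and `[N_{G̃_v}(T̃) : T̃] = |S₃|` (Rogawski 1990, §3.7 Prop. 3.7.1 (a) p. 29: `Ω_F(T, G) = S₃` for type (1); §12.5 p. 182)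

Cell `hodgecm-mathlib`, crux H413 = `stmt-HodgeConjecture-24833`, route of record `HCCMUnconditional`; R90-TF section S4 (Rogawski Ch. 13.1–2, base `R90-C131`), seat
R90-C131-p05 (g2); row (W̃ε-VAL) for TYPE (1) of the (WEYL-COUNT-T) letter of the (B1) T-WIF assembly (consumer: p12's bridge `isTwistedWeylCountT_of_isFinerCount`, whose
`hwF` clause asks, for every regular `t_k` and every `N'` with ★ WEYL-ε's iff-predicate at `Cent(t_k.val)`, for the value of `((Subgroup.centralizer {t_k.val}).subgroupOf N').index`).
THEOREMS ONLY (no `def`, no `instance`, no notation, no named-fact hypothesis, no `sorry`; default heartbeats); ★-only imports; lane `--supports stmt-HodgeConjecture-24833 --as helper`.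

THE MATHEMATICS.  `v` non-split, `G̃_v = GL₃(L ⊗ L⁺_v)` (★ `GtLoc`), `ε = epsLoc L Φ v` (`ε(g) = Φ_v⁻¹ ᵗ(σg)⁻¹ Φ_v`), `γ₀ ∈ G_v = U(Φ)(L⁺_v)` of TYPE (1) with eigenframe
`γ₀ P = P diag(u)` (`u` injective, `σ(uᵢ)uᵢ = 1`), `T̃ := Cent_{G̃_v}(γ₀)`, `Ñ^ε_T := {m ∈ N_{G̃_v}(T̃) : m ε(m)⁻¹ ∈ T̃}` (★ WEYL-ε's predicate, any subgroup `N'` carrying it).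
* §1 `G̃_v` AS A UNITARY GROUP FOR THE ZERO FORM: `U(σ, diag 0) = ⊤` (`unitaryGroupOfForm_diagonal_zero_eq_top`), so ★ F4 A∕B apply to the diagonal torus of `G̃_v` itself:
  its Weyl index is `6` (★ `index_torusU_diagonal_eq_six` at `a := 0`, every permutation admissible).  Conjugation by the frame `P` (`E′ : U(σ, 0) ≃* G̃_v`, `g ↦ P g P⁻¹`)
  carries `diag(u)` to `γ₀`, the diagonal torus to `T̃` (★ `centralizer_eq_torusU_of_isRegularElt` + ★ `map_equiv_centralizer_singleton`) and normalisers to normalisers: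
  **`[N_{G̃_v}(T̃) : T̃] = 6`** (`index_centralizer_subgroupOf_normalizer_eq_six_gtLoc`), and every `m ∈ N_{G̃_v}(T̃)` is `P m′ P⁻¹` with `m′` monomial.
* §2 THE ε-STEP: for `m ∈ N_{G̃_v}(T̃)`, **`m ε(m)⁻¹ ∈ T̃`** (`mul_epsLoc_inv_mem_centralizer_of_mem_normalizer`): with `s(g) := ᵗ(σg)⁻¹` (a homomorphism) and
  `D := ᵗ(σP) Φ_v P = diag(a)` (★ `formCongr_eigenframe_eq_diagonal`: the form is DIAGONAL in the eigenframe), the group identity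
  `P⁻¹ (m ε(m)⁻¹) P = m′ · D⁻¹ · s(m′)⁻¹ · D` (`m′ = P⁻¹ m P`, `s(m′)⁻¹ = ᵗ(σ m′)`) exhibits a product of a `π`-monomial, a diagonal, a `π⁻¹`-monomial and a diagonal matrix —
  DIAGONAL (★ F4 A monomial calculus), hence commuting with `diag(u) = P⁻¹ γ₀ P`.  So `N_{G̃_v}(T̃) ≤ Ñ^ε_T`; with ★ WEYL-ε's `Ñ^ε_T ≤ N_{G̃_v}(T̃)`:
  **`Ñ^ε_T = N_{G̃_v}(T̃)`** (`epsNormalizer_eq_normalizer_of_typeOne`) and **`[Ñ^ε_T : T̃] = 6`** (`index_centralizer_subgroupOf_epsNormalizer_eq_six_of_typeOne`) for BOTH type-(1)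
  classes `T₁, T₂` — print's `Ω_F(T, G) = S₃` [Prop. 3.7.1 (a)], versus `[N_U(T) : T] ∈ {6, 2}` (★ F4 C): the finer fact S4-R27 (2′).

HONEST LABEL: HC_CM is proved only modulo the 7 printed citations (2 remaining named inputs: hLiu418 = `stmt-HodgeConjecture-24832`, h413 = `stmt-HodgeConjecture-24833`) until
rung 0 closes; (W̃ε-VAL)(1) is one per-type input of (WEYL-COUNT-T) of the (B1) assembly behind the OPEN (W-NP) socket — a ★ helper closes no socket; REL ≠ ★ ≠ BUILT; count-neutral.

## References
* [Rogawski1990] J. D. Rogawski, *Automorphic Representations of Unitary Groups in Three Variables*, Ann. of Math. Stud. 123 (1990), §3.7 Prop. 3.7.1 (a) p. 29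
  (`Ω_F(T,G) = S₃` for type (1)), §12.5 pp. 182, 186 (the twisted Weyl integration formula), §3.10–3.11 pp. 33–35 (`ε`, norms).
* [SpringerLAG1998] T. A. Springer, *Linear Algebraic Groups*, 2nd ed. (1998), 7.1.5.
-/

set_option autoImplicit false
-- the mandated namespace repeats the single-problem summit's segment (`HodgeConjecture.HodgeConjecture`)
set_option linter.dupNamespace false

open Matrix Polynomial
open NumberField IsDedekindDomain
open Literature.NumberTheory.Automorphic Literature.NumberTheory.Automorphic.UnitaryGroup Literature.NumberTheory.Rogawski1990
open Literature.NumberTheory.GaloisRepresentations (glTransposeInv)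
open Summit.HodgeConjecture.HodgeConjecture.Cruxes.H413.F0P3cStCharTSWeylHypFibre
open Summit.HodgeConjecture.HodgeConjecture.Cruxes.H413.F0P3cStCharTSWeylHypCM
open Summit.HodgeConjecture.HodgeConjecture.Cruxes.H413.K2E1GlobalTestFunctionsTwisted (formLocal twistLocal twistLocal_apply)
open scoped MatrixGroups

namespace Summit.HodgeConjecture.HodgeConjecture.R90.S4

/-! ## §1 `GL₃` as the unitary group of the zero form; the Weyl index of `Cent_{G̃_v}(γ₀)` is `6` -/

section GtLoc

variable {R : Type*} [CommRing R] (σ : R →+* R) {N : ℕ}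

/-- **`U(σ, diag 0) = GL_N`**: every invertible matrix preserves the zero form. [folklore] -/
theorem unitaryGroupOfForm_diagonal_zero_eq_top : unitaryGroupOfForm σ (diagonal (0 : Fin N → R)) = ⊤ := by
  refine Subgroup.ext fun g => ⟨fun _ => Subgroup.mem_top g, fun _ => ?_⟩
  have h0 : diagonal (0 : Fin N → R) = 0 := by
    ext i j
    rw [diagonal_apply, Matrix.zero_apply, Pi.zero_apply, ite_self]
  rw [mem_unitaryGroupOfForm_iff, h0, Matrix.mul_zero, Matrix.zero_mul]

/-- Every permutation is admissible for the zero form: `σ(1) · 0 · 1 = 0`. [folklore] -/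
theorem forall_normRel_zero (i j : Fin N) : ∃ c : R, IsUnit c ∧ σ c * (0 : Fin N → R) i * c = (0 : Fin N → R) j :=
  ⟨1, isUnit_one, by rw [Pi.zero_apply, Pi.zero_apply, mul_zero, zero_mul]⟩

end GtLoc

section TypeOne

variable (L : Type) [Field L] [NumberField L] [IsCMField L] (Φ : GL (Fin 3) L) (v : HeightOneSpectrum (𝓞 ↥(maximalRealSubfield L)))

/-- **THE FRAME TRANSPORT FOR `G̃_v`**: for `γ₀ ∈ U(Φ)(L⁺_v)` with eigenframe `γ₀ P = P diag(u)` (`u` injective, `σ(uᵢ)uᵢ = 1`, `v` non-split) there is an isomorphism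
`E′ : U(σ, diag 0) ≃* G̃_v` with `E′ g = P g P⁻¹`, carrying the diagonal torus onto `T̃ = Cent_{G̃_v}(γ₀)` and its normaliser onto `N_{G̃_v}(T̃)`, and the diagonal torus of
`U(σ, diag 0) = GL₃` has a regular element (`diag u`). [cite: Rogawski1990, §3.7 Prop. 3.7.1 p. 29; §3.6 p. 28] [cite: SpringerLAG1998, 7.1.5] -/
theorem exists_mulEquiv_torusU_zero_map_eq_centralizer (hns : ∀ w : PlacesOver L v, IsCMField.complexConj L • w.1 = w.1)
    (γ₀ : (UnitaryGroup.cmDatum L 3 (Φ : Matrix (Fin 3) (Fin 3) L)).Local v) (u : Fin 3 → LocalRing L v) (hu : Function.Injective u)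
    (hu1 : ∀ i, conjLocal L (IsCMField.complexConj L) v (u i) * u i = 1)
    (P : GL (Fin 3) (LocalRing L v)) (hP : (γ₀.val : GL (Fin 3) (LocalRing L v)).val * P.val = P.val * diagonal u) :
    ∃ E' : ↥(unitaryGroupOfForm (conjLocal L (IsCMField.complexConj L) v) (diagonal (0 : Fin 3 → LocalRing L v))) ≃* GtLoc L v,
      (∀ g, E' g = P * (g : GL (Fin 3) (LocalRing L v)) * P⁻¹) ∧
      (torusU (conjLocal L (IsCMField.complexConj L) v) (diagonal (0 : Fin 3 → LocalRing L v))).map E'.toMonoidHom =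
        Subgroup.centralizer ({(γ₀.val : GtLoc L v)} : Set (GtLoc L v)) ∧
      (Subgroup.normalizer (torusU (conjLocal L (IsCMField.complexConj L) v) (diagonal (0 : Fin 3 → LocalRing L v)) : Set _)).map E'.toMonoidHom =
        Subgroup.normalizer ((Subgroup.centralizer ({(γ₀.val : GtLoc L v)} : Set (GtLoc L v)) : Subgroup (GtLoc L v)) : Set (GtLoc L v)) ∧
      ∃ m : ↥(unitaryGroupOfForm (conjLocal L (IsCMField.complexConj L) v) (diagonal (0 : Fin 3 → LocalRing L v))),
        m ∈ torusU (conjLocal L (IsCMField.complexConj L) v) (diagonal (0 : Fin 3 → LocalRing L v)) ∧ IsRegularElt (m : GL (Fin 3) (LocalRing L v)) := by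
  set σv := conjLocal L (IsCMField.complexConj L) v with hσv
  have hR := isUnit_of_ne_zero_of_nonsplit L v hns
  have hU0 := unitaryGroupOfForm_diagonal_zero_eq_top σv (N := 3)
  -- `E′ = conj(P) ∘ topEquiv ∘ subgroupCongr`
  let E' : ↥(unitaryGroupOfForm σv (diagonal (0 : Fin 3 → LocalRing L v))) ≃* GtLoc L v :=
    ((MulEquiv.subgroupCongr hU0).trans Subgroup.topEquiv).trans (MulAut.conj P)
  have hE' : ∀ g, E' g = P * (g : GL (Fin 3) (LocalRing L v)) * P⁻¹ := fun g => rfl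
  -- `Λ := E′⁻¹ γ₀ = diag(u)`, a regular element of the diagonal torus
  set Λ : ↥(unitaryGroupOfForm σv (diagonal (0 : Fin 3 → LocalRing L v))) := E'.symm (γ₀.val : GtLoc L v) with hΛdef
  have hΛval : ((Λ : ↥(unitaryGroupOfForm σv (diagonal (0 : Fin 3 → LocalRing L v)))) : GL (Fin 3) (LocalRing L v)) =
      P⁻¹ * (γ₀.val : GL (Fin 3) (LocalRing L v)) * P := rfl
  have hPinvP : (P⁻¹ : GL (Fin 3) (LocalRing L v)).val * P.val = 1 := by
    rw [← Units.val_mul, inv_mul_cancel, Units.val_one]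
  have hΛmat : (((Λ : ↥(unitaryGroupOfForm σv (diagonal (0 : Fin 3 → LocalRing L v)))) : GL (Fin 3) (LocalRing L v))).val = diagonal u := by
    rw [hΛval, Units.val_mul, Units.val_mul, Matrix.mul_assoc, hP, ← Matrix.mul_assoc, hPinvP, Matrix.one_mul]
  let d : Fin 3 → (LocalRing L v)ˣ := fun i => ⟨u i, σv (u i), by rw [mul_comm]; exact hu1 i, hu1 i⟩
  have hdΛ : glDiagonal 3 (LocalRing L v) d = ((Λ : ↥(unitaryGroupOfForm σv (diagonal (0 : Fin 3 → LocalRing L v)))) : GL (Fin 3) (LocalRing L v)) :=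
    Units.ext (by rw [coe_glDiagonal, hΛmat])
  have hΛT : Λ ∈ torusU σv (diagonal (0 : Fin 3 → LocalRing L v)) := ⟨d, by rw [Subgroup.coe_subtype]; exact hdΛ⟩
  have hΛreg : IsRegularElt ((Λ : ↥(unitaryGroupOfForm σv (diagonal (0 : Fin 3 → LocalRing L v)))) : GL (Fin 3) (LocalRing L v)) := by
    rw [IsRegularElt, hΛmat, charpoly_diagonal]
    exact Polynomial.separable_prod (fun i j hij => isCoprime_X_sub_C_of_isUnit_sub (hR _ (sub_ne_zero.2 (hu.ne hij))))
      fun _ => Polynomial.separable_X_sub_C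
  have hT : Subgroup.centralizer ({Λ} : Set _) = torusU σv (diagonal (0 : Fin 3 → LocalRing L v)) :=
    centralizer_eq_torusU_of_isRegularElt σv _ hΛT hΛreg
  have hZ : (torusU σv (diagonal (0 : Fin 3 → LocalRing L v))).map E'.toMonoidHom = Subgroup.centralizer ({(γ₀.val : GtLoc L v)} : Set (GtLoc L v)) := by
    rw [← hT, map_equiv_centralizer_singleton, hΛdef, MulEquiv.apply_symm_apply]
  have hN : (Subgroup.normalizer (torusU σv (diagonal (0 : Fin 3 → LocalRing L v)) : Set _)).map E'.toMonoidHom =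
      Subgroup.normalizer ((Subgroup.centralizer ({(γ₀.val : GtLoc L v)} : Set (GtLoc L v)) : Subgroup (GtLoc L v)) : Set (GtLoc L v)) := by
    rw [Subgroup.map_equiv_normalizer_eq, hZ]
  exact ⟨E', hE', hZ, hN, Λ, hΛT, hΛreg⟩

/-- **`[N_{G̃_v}(T̃) : T̃] = 6` for `T̃ = Cent_{G̃_v}(γ₀)`, `γ₀` of type (1)** (`v` non-split): the `G̃_v`-side Weyl group of a type-(1) torus is all of `S₃` — ★ F4 B
`index_torusU_diagonal_eq_six` at the zero form (every permutation admissible) transported along the frame. [cite: Rogawski1990, §3.7 Prop. 3.7.1 (a) p. 29] -/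
theorem index_centralizer_subgroupOf_normalizer_eq_six_gtLoc (hns : ∀ w : PlacesOver L v, IsCMField.complexConj L • w.1 = w.1)
    (γ₀ : (UnitaryGroup.cmDatum L 3 (Φ : Matrix (Fin 3) (Fin 3) L)).Local v) (u : Fin 3 → LocalRing L v) (hu : Function.Injective u)
    (hu1 : ∀ i, conjLocal L (IsCMField.complexConj L) v (u i) * u i = 1)
    (P : GL (Fin 3) (LocalRing L v)) (hP : (γ₀.val : GL (Fin 3) (LocalRing L v)).val * P.val = P.val * diagonal u) :
    ((Subgroup.centralizer ({(γ₀.val : GtLoc L v)} : Set (GtLoc L v))).subgroupOf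
      (Subgroup.normalizer ((Subgroup.centralizer ({(γ₀.val : GtLoc L v)} : Set (GtLoc L v)) : Subgroup (GtLoc L v)) : Set (GtLoc L v)))).index = 6 := by
  haveI : Nontrivial (LocalRing L v) := UnitaryGroup.nontrivial_localRing L v
  obtain ⟨E', -, hZ, -, hex⟩ := exists_mulEquiv_torusU_zero_map_eq_centralizer L Φ v hns γ₀ u hu hu1 P hP
  rw [index_centralizer_subgroupOf_normalizer_eq_of_map_equiv E' _ _ hZ]
  exact index_torusU_diagonal_eq_six (conjLocal L (IsCMField.complexConj L) v) (0 : Fin 3 → LocalRing L v) (isUnit_of_ne_zero_of_nonsplit L v hns) hex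
    (forall_normRel_zero _)

/-! ## §2 The ε-step: the ε-normaliser of a type-(1) `T̃` is the full normaliser -/

/-- **THE ε-STEP: `m · ε(m)⁻¹ ∈ T̃` for every `m ∈ N_{G̃_v}(T̃)`**, `T̃ = Cent_{G̃_v}(γ₀)`, `γ₀` of type (1), `ε = epsLoc L Φ v` (`v` non-split).  In the eigenframe `m′ = P⁻¹ m P` is
`π`-monomial (★ F4 A) and the Gram matrix `D = ᵗ(σP) Φ_v P` is DIAGONAL (★ `formCongr_eigenframe_eq_diagonal`); the group identity `P⁻¹ (m ε(m)⁻¹) P = m′ D⁻¹ ᵗ(σm′) D`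
(`s = ᵗ(σ·)⁻¹` is a homomorphism) exhibits a `π · 1 · π⁻¹ · 1`-monomial, i.e. DIAGONAL, matrix, which commutes with `diag(u) = P⁻¹ γ₀ P`.
[cite: Rogawski1990, §3.7 Prop. 3.7.1 (a) p. 29; §3.10 p. 33; §12.5 p. 186] [cite: SpringerLAG1998, 7.1.5] -/
theorem mul_epsLoc_inv_mem_centralizer_of_mem_normalizer (hns : ∀ w : PlacesOver L v, IsCMField.complexConj L • w.1 = w.1)
    (γ₀ : (UnitaryGroup.cmDatum L 3 (Φ : Matrix (Fin 3) (Fin 3) L)).Local v) (u : Fin 3 → LocalRing L v) (hu : Function.Injective u)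
    (hu1 : ∀ i, conjLocal L (IsCMField.complexConj L) v (u i) * u i = 1)
    (P : GL (Fin 3) (LocalRing L v)) (hP : (γ₀.val : GL (Fin 3) (LocalRing L v)).val * P.val = P.val * diagonal u)
    {m : GtLoc L v} (hm : m ∈ Subgroup.normalizer ((Subgroup.centralizer ({(γ₀.val : GtLoc L v)} : Set (GtLoc L v)) : Subgroup (GtLoc L v)) : Set (GtLoc L v))) :
    m * (epsLoc L Φ v m)⁻¹ ∈ Subgroup.centralizer ({(γ₀.val : GtLoc L v)} : Set (GtLoc L v)) := by
  haveI : Nontrivial (LocalRing L v) := UnitaryGroup.nontrivial_localRing L v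
  set σv := conjLocal L (IsCMField.complexConj L) v with hσv
  have hR := isUnit_of_ne_zero_of_nonsplit L v hns
  obtain ⟨E', hE', hZ, hN, hex⟩ := exists_mulEquiv_torusU_zero_map_eq_centralizer L Φ v hns γ₀ u hu hu1 P hP
  -- `m′ := E′⁻¹ m = P⁻¹ m P` is monomial
  have hm0 : E'.symm m ∈ Subgroup.normalizer (torusU σv (diagonal (0 : Fin 3 → LocalRing L v)) : Set _) := by
    rw [← Subgroup.mem_map_equiv, hN]
    exact hm
  obtain ⟨π, hπ⟩ := exists_perm_monomial_of_mem_normalizer_torusU σv _ hR hex hm0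
  have hm'val : ((E'.symm m : ↥(unitaryGroupOfForm σv (diagonal (0 : Fin 3 → LocalRing L v)))) : GL (Fin 3) (LocalRing L v)) = P⁻¹ * m * P := by
    have h := hE' (E'.symm m)
    rw [MulEquiv.apply_symm_apply] at h
    calc ((E'.symm m : ↥(unitaryGroupOfForm σv (diagonal (0 : Fin 3 → LocalRing L v)))) : GL (Fin 3) (LocalRing L v))
        = P⁻¹ * (P * ((E'.symm m : ↥(unitaryGroupOfForm σv (diagonal (0 : Fin 3 → LocalRing L v)))) : GL (Fin 3) (LocalRing L v)) * P⁻¹) * P := by group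
      _ = P⁻¹ * m * P := by rw [← h]
  -- letters: `M′ = P⁻¹ m P` (π-monomial), `D = ᵗ(σP) Φ_v P` (diagonal), `S = ᵗ(σ M′)` (π⁻¹-monomial)
  obtain ⟨M', hM'⟩ : ∃ M' : GL (Fin 3) (LocalRing L v), M' = P⁻¹ * m * P := ⟨_, rfl⟩
  have hπ' : ∀ i j, j ≠ π i → M'.val j i = 0 := by
    intro i j hj
    have := hπ i j hj
    rwa [hm'val, ← hM'] at this
  obtain ⟨D, hD⟩ : ∃ D : GL (Fin 3) (LocalRing L v),
      D = (glTransposeInv (Fin 3) (LocalRing L v) (Matrix.GeneralLinearGroup.map σv P))⁻¹ * formLocal L 3 Φ v * P := ⟨_, rfl⟩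
  have hDval : D.val = diagonal fun i => twistGram σv ((Φ : Matrix (Fin 3) (Fin 3) L).map (algebraMap L (LocalRing L v))) P.val i i := by
    rw [hD, Units.val_mul, Units.val_mul]
    exact formCongr_eigenframe_eq_diagonal L (Φ : Matrix (Fin 3) (Fin 3) L) v hns γ₀ u hu hu1 P hP
  have hD1 : ∀ i j, j ≠ (1 : Equiv.Perm (Fin 3)) i → D.val j i = 0 := fun i j hj => by
    rw [hDval, diagonal_apply_ne _ (by rwa [Equiv.Perm.one_apply] at hj)]
  have hDinv1 : ∀ i j, j ≠ (1 : Equiv.Perm (Fin 3)) i → (D⁻¹ : GL (Fin 3) (LocalRing L v)).val j i = 0 := by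
    have h := (monomial_inv hD1 (show (D⁻¹ : GL (Fin 3) (LocalRing L v)).val * D.val = 1 by
      rw [← Units.val_mul, inv_mul_cancel, Units.val_one])).2
    rwa [inv_one] at h
  obtain ⟨S, hS⟩ : ∃ S : GL (Fin 3) (LocalRing L v), S = (glTransposeInv (Fin 3) (LocalRing L v) (Matrix.GeneralLinearGroup.map σv M'))⁻¹ := ⟨_, rfl⟩
  have hSval : S.val = (M'.val.map σv)ᵀ := by rw [hS]; rfl
  have hsM' : ∀ i j, j ≠ π⁻¹ i → S.val j i = 0 := by
    intro i j hj
    rw [hSval, transpose_apply, map_apply, hπ' j i (fun e => hj (by rw [e]; exact (π.symm_apply_apply j).symm)), map_zero]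
  -- the group identity `P⁻¹ (m ε(m)⁻¹) P = M′ · D⁻¹ · S · D` (`ᵗ(σ·)⁻¹` is a homomorphism)
  have hX : P⁻¹ * (m * (epsLoc L Φ v m)⁻¹) * P = M' * D⁻¹ * S * D := by
    rw [hS, hD, hM', epsLoc_apply, twistLocal_apply, ← hσv]
    simp only [map_mul, map_inv]
    group
  -- hence `X := P⁻¹ (m ε(m)⁻¹) P` is diagonal
  have hXmon := monomial_mul (monomial_mul (monomial_mul hπ' hDinv1) hsM') hD1
  have hperm : π * 1 * π⁻¹ * 1 = 1 := by group
  rw [hperm, ← Units.val_mul, ← Units.val_mul, ← Units.val_mul, ← hX] at hXmon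
  obtain ⟨X, hXdef⟩ : ∃ X : GL (Fin 3) (LocalRing L v), X = P⁻¹ * (m * (epsLoc L Φ v m)⁻¹) * P := ⟨_, rfl⟩
  rw [← hXdef] at hXmon
  have hXdiag := (monomial_one_iff _).1 hXmon
  have hXd : X.val = diagonal fun i => X.val i i := by
    ext i j
    by_cases hij : i = j
    · subst hij; rw [diagonal_apply_eq]
    · rw [diagonal_apply_ne _ hij, hXdiag i j hij]
  -- and commutes with `Λ := P⁻¹ γ₀ P = diag(u)`
  obtain ⟨Λg, hΛg⟩ : ∃ Λg : GL (Fin 3) (LocalRing L v), Λg = P⁻¹ * (γ₀.val : GL (Fin 3) (LocalRing L v)) * P := ⟨_, rfl⟩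
  have hPinvP : (P⁻¹ : GL (Fin 3) (LocalRing L v)).val * P.val = 1 := by
    rw [← Units.val_mul, inv_mul_cancel, Units.val_one]
  have hΛmat : Λg.val = diagonal u := by
    rw [hΛg, Units.val_mul, Units.val_mul, Matrix.mul_assoc, hP, ← Matrix.mul_assoc, hPinvP, Matrix.one_mul]
  have hcomm : X * Λg = Λg * X := by
    refine Units.ext ?_
    rw [Units.val_mul, Units.val_mul, hΛmat, hXd, diagonal_mul_diagonal, diagonal_mul_diagonal]
    exact congrArg diagonal (funext fun i => mul_comm _ _)
  rw [Subgroup.mem_centralizer_singleton_iff]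
  have hY : m * (epsLoc L Φ v m)⁻¹ = P * X * P⁻¹ := by rw [hXdef]; group
  have hγ : (γ₀.val : GtLoc L v) = P * Λg * P⁻¹ := by rw [hΛg]; group
  rw [hY, hγ]
  calc P * X * P⁻¹ * (P * Λg * P⁻¹) = P * (X * Λg) * P⁻¹ := by group
    _ = P * (Λg * X) * P⁻¹ := by rw [hcomm]
    _ = P * Λg * P⁻¹ * (P * X * P⁻¹) := by group

/-- **The ε-normaliser of a type-(1) `T̃ = Cent_{G̃_v}(γ₀)` is the FULL normaliser**: any subgroup `N'` with ★ WEYL-ε's membership predicate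
(`m ∈ N(T̃) ∧ m ε(m)⁻¹ ∈ T̃`) equals `N_{G̃_v}(T̃)` (§2 ε-step + ★ `le_normalizer_of_mem_iff_epsNormalizer`). [cite: Rogawski1990, §3.7 Prop. 3.7.1 (a) p. 29; §12.5 p. 186] -/
theorem epsNormalizer_eq_normalizer_of_typeOne (hns : ∀ w : PlacesOver L v, IsCMField.complexConj L • w.1 = w.1)
    (γ₀ : (UnitaryGroup.cmDatum L 3 (Φ : Matrix (Fin 3) (Fin 3) L)).Local v) (u : Fin 3 → LocalRing L v) (hu : Function.Injective u)
    (hu1 : ∀ i, conjLocal L (IsCMField.complexConj L) v (u i) * u i = 1)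
    (P : GL (Fin 3) (LocalRing L v)) (hP : (γ₀.val : GL (Fin 3) (LocalRing L v)).val * P.val = P.val * diagonal u)
    (N' : Subgroup (GtLoc L v))
    (hN' : ∀ m, m ∈ N' ↔
      m ∈ Subgroup.normalizer ((Subgroup.centralizer ({(γ₀.val : GtLoc L v)} : Set (GtLoc L v)) : Subgroup (GtLoc L v)) : Set (GtLoc L v)) ∧
        m * (epsLoc L Φ v m)⁻¹ ∈ Subgroup.centralizer ({(γ₀.val : GtLoc L v)} : Set (GtLoc L v))) :
    N' = Subgroup.normalizer ((Subgroup.centralizer ({(γ₀.val : GtLoc L v)} : Set (GtLoc L v)) : Subgroup (GtLoc L v)) : Set (GtLoc L v)) :=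
  le_antisymm (le_normalizer_of_mem_iff_epsNormalizer L Φ v γ₀ N' hN')
    fun _ hm => (hN' _).2 ⟨hm, mul_epsLoc_inv_mem_centralizer_of_mem_normalizer L Φ v hns γ₀ u hu hu1 P hP hm⟩

/-- **(W̃ε-VAL)(1): `[Ñ^ε_T : T̃] = 6` for every type-(1) `γ₀`** (`v` non-split; eigenframe letter `u hu hu1 P hP`; `N'` any subgroup of `G̃_v` with ★ WEYL-ε's iff-predicate at
`T̃ = Cent_{G̃_v}(γ₀)`): the `hwF` value `wF = 6` of p12's (WEYL-COUNT-T) bridge at type (1) — for BOTH classes `T₁`, `T₂` (print: `Ω_F(T, G) = S₃`), whereas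
`[N_U(T) : T] ∈ {6, 2}` (★ F4 C). [cite: Rogawski1990, §3.7 Prop. 3.7.1 (a) p. 29; §12.5 pp. 182, 186] -/
theorem index_centralizer_subgroupOf_epsNormalizer_eq_six_of_typeOne (hns : ∀ w : PlacesOver L v, IsCMField.complexConj L • w.1 = w.1)
    (γ₀ : (UnitaryGroup.cmDatum L 3 (Φ : Matrix (Fin 3) (Fin 3) L)).Local v) (u : Fin 3 → LocalRing L v) (hu : Function.Injective u)
    (hu1 : ∀ i, conjLocal L (IsCMField.complexConj L) v (u i) * u i = 1)
    (P : GL (Fin 3) (LocalRing L v)) (hP : (γ₀.val : GL (Fin 3) (LocalRing L v)).val * P.val = P.val * diagonal u)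
    (N' : Subgroup (GtLoc L v))
    (hN' : ∀ m, m ∈ N' ↔
      m ∈ Subgroup.normalizer ((Subgroup.centralizer ({(γ₀.val : GtLoc L v)} : Set (GtLoc L v)) : Subgroup (GtLoc L v)) : Set (GtLoc L v)) ∧
        m * (epsLoc L Φ v m)⁻¹ ∈ Subgroup.centralizer ({(γ₀.val : GtLoc L v)} : Set (GtLoc L v))) :
    ((Subgroup.centralizer ({(γ₀.val : GtLoc L v)} : Set (GtLoc L v))).subgroupOf N').index = 6 := by
  rw [epsNormalizer_eq_normalizer_of_typeOne L Φ v hns γ₀ u hu hu1 P hP N' hN']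
  exact index_centralizer_subgroupOf_normalizer_eq_six_gtLoc L Φ v hns γ₀ u hu hu1 P hP

/-- **`W̃^ε_T` has exactly `6` elements** (type (1), `v` non-split): `Nat.card (Ñ^ε_T ⧸ T̃) = 6`. [cite: Rogawski1990, §3.7 Prop. 3.7.1 (a) p. 29; §12.5 p. 182] -/
theorem natCard_epsNormalizer_quotient_centralizer_eq_six_of_typeOne (hns : ∀ w : PlacesOver L v, IsCMField.complexConj L • w.1 = w.1)
    (γ₀ : (UnitaryGroup.cmDatum L 3 (Φ : Matrix (Fin 3) (Fin 3) L)).Local v) (u : Fin 3 → LocalRing L v) (hu : Function.Injective u)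
    (hu1 : ∀ i, conjLocal L (IsCMField.complexConj L) v (u i) * u i = 1)
    (P : GL (Fin 3) (LocalRing L v)) (hP : (γ₀.val : GL (Fin 3) (LocalRing L v)).val * P.val = P.val * diagonal u)
    (N' : Subgroup (GtLoc L v))
    (hN' : ∀ m, m ∈ N' ↔
      m ∈ Subgroup.normalizer ((Subgroup.centralizer ({(γ₀.val : GtLoc L v)} : Set (GtLoc L v)) : Subgroup (GtLoc L v)) : Set (GtLoc L v)) ∧
        m * (epsLoc L Φ v m)⁻¹ ∈ Subgroup.centralizer ({(γ₀.val : GtLoc L v)} : Set (GtLoc L v))) :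
    Nat.card (↥N' ⧸ (Subgroup.centralizer ({(γ₀.val : GtLoc L v)} : Set (GtLoc L v))).subgroupOf N') = 6 := by
  rw [← Subgroup.index_eq_card]
  exact index_centralizer_subgroupOf_epsNormalizer_eq_six_of_typeOne L Φ v hns γ₀ u hu hu1 P hP N' hN'

end TypeOne

end Summit.HodgeConjecture.HodgeConjecture.R90.S4
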